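import Literature.NumberTheory.GaloisRepresentations.LocalEulerPoincareCharacteristic
import Literature.NumberTheory.GaloisRepresentations.LocalPowerClassIndex
import Literature.NumberTheory.GaloisRepresentations.LocalCorInjective
import Literature.NumberTheory.GaloisRepresentations.GaloisRepUnramifiedProofs
import Literature.NumberTheory.Automorphic.AdicCompletionLocalField
import HarnessLib

/-!
# Tate's local Euler–Poincaré characteristic formula for `μ_n` over `K_v` (Milne I Thm. 2.8, case `M = μ_n`)

Topic `NumberTheory/GaloisRepresentations`; namespace `Literature.NumberTheory.GaloisRepresentations`.
Theorems only (no definition, no named fact; D-0026).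

The tree's named fact `localEulerPoincareCharacteristic F` (Milne, *Arithmetic Duality Theorems*,
I Thm. 2.8; Serre, *Cohomologie galoisienne*, II §5.7 Thm. 5: `#H⁰ · #H² · (𝒪 : m𝒪) = #H¹` for a
finite discrete `Γ_F`-module of order `m`) is proved in the tree when `#M` is prime to the residue
characteristic (`PrimeToPEulerChar`).  This file proves the first `p`-adic case, the module
`M = μ_n = μ_n(K̄_v)` (any `n ≥ 1`) over the completion `K_v` of a number field `K` at a finite
place `v` — the base case of every printed proof of the theorem (Serre, loc. cit., proof of
Lemme 5: "`H¹(L, ℤ/pℤ)` = dual de `L*/L*ᵖ` … `H²(L, ℤ/pℤ)` = dual de `H⁰(L, μ_p)`"; Milne I 2.8,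
last display of the proof), where it IS the classical index formula
`(K_vˣ : K_vˣⁿ) = n · #μ_n(K_v) · (𝒪_v : n𝒪_v)` (Neukirch, *Algebraic Number Theory*, II (5.8)):

* `natCard_invariants_mu` — `#μ_n(F̄)^{Γ_F} = #μ_n(F)` for any field `F` of characteristic `0`
  (an invariant root of unity lies in `F`: the fixed field of `Γ_F` is `F`);
* `natCard_rootsOfUnity_adicCompletion_eq` — `#μ_n(K_v) = #𝒪_vˣ[n]` (roots of unity are units);
* `natCard_continuousCohomology_one_mu_adicCompletion` — **`#H¹(K_v, μ_n) = n · #𝒪_vˣ[n] · #(𝒪_v/n)`**: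
  Kummer theory `H¹(K_v, μ_n) ≅ K_vˣ/K_vˣⁿ` (tree `kummerEquiv`) and the tree's index theorems
  `index_range_powMonoidHom_eq_mul_units`, `index_range_powMonoidHom_units` (`LocalPowerClassIndex`);
* `localEulerPoincareCharacteristic_mu_adicCompletion` — **the conclusion of
  `localEulerPoincareCharacteristic (v.adicCompletion K)` for the module `μ_n`**:
  `H¹(K_v, μ_n)`, `H²(K_v, μ_n)` are finite and
  `#μ_n^{Γ} · #H²(K_v, μ_n) · #(𝒪[K_v]/(#μ_n)) = #H¹(K_v, μ_n)`.

## References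
* J. S. Milne, *Arithmetic Duality Theorems*, 2nd ed. (2006), I Thm. 2.8 (p. 31). [MilneADT2006]
* J.-P. Serre, *Galois Cohomology* (1997), II §5.7 Thm. 5, Lemme 5. [SerreGaloisCohomology1997]
* J. Neukirch, *Algebraic Number Theory* (1999), II (5.8). [NeukirchANT1999]
-/

noncomputable section

open CategoryTheory Function
open Field IsNonarchimedeanLocalField

universe u

namespace Literature.NumberTheory.GaloisRepresentations

open _root_.TopRep _root_.ContRepresentation _root_.ContinuousCohomology DiscreteGaloisModule
open LocalWeilDatum NumberField IsDedekindDomain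

/-! ### The invariants of `μ_n(F̄)` are the `n`-th roots of unity of `F` -/

section Invariants

variable (F : Type u) [Field F] [CharZero F] (n : ℕ) [NeZero n]

/-- **`#μ_n(F̄)^{Γ_F} = #μ_n(F)`** for a field `F` of characteristic `0` (`H⁰(F, μ_n) = μ_n(F)`): a
`Γ_F`-invariant element of `F̄` lies in `F` (the fixed field of `Γ_F = Aut_F(F̄)` is `F`, `F` being
perfect), so the invariants of the Galois module `μ_n = μ_n(F̄)` are the `n`-th roots of unity of `F`,
via `ζ ↦ ζ`. [cite: SerreGaloisCohomology1997, II §1.2 (Kummer theory: `H⁰(k, μ_n) = μ_n ∩ k*`)] -/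
theorem natCard_invariants_mu :
    Nat.card (mu F n).toTopRep.ρ.invariants = Nat.card (rootsOfUnity n F) := by
  classical
  -- `ζ ↦ ζ ∈ μ_n(F̄)`
  let toMu : rootsOfUnity n F → MuCarrier F n := fun ζ =>
    MuCarrier.ofRootsOfUnity
      ⟨Units.map (algebraMap F (AlgebraicClosure F)).toMonoidHom ζ.1, by
        rw [mem_rootsOfUnity, ← map_pow, (mem_rootsOfUnity n (ζ : Fˣ)).1 ζ.2, map_one]⟩
  have hval : ∀ ζ : rootsOfUnity n F, (muVal F n (toMu ζ) : AlgebraicClosure F) =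
      algebraMap F (AlgebraicClosure F) ((ζ : Fˣ) : F) := fun ζ => rfl
  have hmem : ∀ ζ : rootsOfUnity n F, toMu ζ ∈ (mu F n).toTopRep.ρ.invariants := by
    intro ζ
    rw [ContRepresentation.mem_invariants]
    intro σ
    rw [ContinuousRep.toTopRep_ρ_apply]
    apply muVal_injective
    rw [muVal_apply]
    ext
    rw [Units.coe_smul, hval, absoluteGaloisGroup.smul_def, AlgEquiv.commutes]
  symm
  refine Nat.card_eq_of_bijective
    (fun ζ => (⟨toMu ζ, hmem ζ⟩ : (mu F n).toTopRep.ρ.invariants)) ⟨?_, ?_⟩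
  · intro ζ ζ' h
    have h1 := congrArg (fun w : (mu F n).toTopRep.ρ.invariants =>
      (muVal F n w.1 : AlgebraicClosure F)) h
    simp only [hval] at h1
    exact Subtype.ext (Units.ext ((algebraMap F (AlgebraicClosure F)).injective h1))
  · rintro ⟨w, hw⟩
    rw [ContRepresentation.mem_invariants] at hw
    -- the underlying element of `F̄` is `Γ_F`-fixed, hence in `F`
    have hfix : ∀ σ : absoluteGaloisGroup F,
        σ • (muVal F n w : AlgebraicClosure F) = muVal F n w := fun σ =>
      congrArg (fun x => (muVal F n x : AlgebraicClosure F)) (hw σ)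
    obtain ⟨m, y, hy⟩ := absoluteGaloisGroup.exists_algebraMap_eq_pow_of_forall_smul_eq F 1 hfix
    rw [one_pow, pow_one] at hy
    have hyn : y ^ n = 1 := by
      apply (algebraMap F (AlgebraicClosure F)).injective
      rw [map_pow, hy, ← Units.val_pow_eq_pow_val, muVal_pow_eq_one, Units.val_one, map_one]
    refine ⟨rootsOfUnity.mkOfPowEq y hyn, Subtype.ext ?_⟩
    apply muVal_injective
    ext
    rw [hval, rootsOfUnity.val_mkOfPowEq_coe, hy]

end Invariants

/-! ### The completion `K_v`: roots of unity, Kummer theory and the index `(K_vˣ : K_vˣⁿ)` -/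

section AdicCompletion

open Valued

variable (K : Type u) [Field K] [NumberField K] (v : HeightOneSpectrum (𝓞 K))

/-- **`#μ_n(K_v) = #𝒪_vˣ[n]`**: the `n`-th roots of unity of `K_v` are units of `𝒪_v`
(their valuation is an `n`-torsion element of `ℤ`, i.e. `1`), so `ζ ↦ ζ` is a bijection from the
`n`-torsion of `𝒪_vˣ` onto `μ_n(K_v)`. [cite: NeukirchANT1999, Ch. II §5 Prop. (5.3) and (5.7) (roots of unity in `U_K`)] -/
theorem natCard_rootsOfUnity_adicCompletion_eq {n : ℕ} (hn : n ≠ 0) :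
    Nat.card (rootsOfUnity n (v.adicCompletion K)) =
      Nat.card (powMonoidHom n : (𝒪[v.adicCompletion K])ˣ →* (𝒪[v.adicCompletion K])ˣ).ker := by
  haveI : NeZero n := ⟨hn⟩
  set ι : (𝒪[v.adicCompletion K])ˣ →* (v.adicCompletion K)ˣ :=
    Units.map ((Valued.integer (v.adicCompletion K)).subtype.toMonoidHom) with hι
  have hι_inj : Function.Injective ι := fun a b h ↦ by
    apply Units.ext; apply Subtype.ext
    have := congrArg (fun u : (v.adicCompletion K)ˣ ↦ (u : (v.adicCompletion K))) h
    simpa [hι] using this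
  symm
  refine Nat.card_eq_of_bijective
    (fun u => (⟨ι u.1, ?_⟩ : rootsOfUnity n (v.adicCompletion K))) ⟨?_, ?_⟩
  · have hu := u.2
    rw [MonoidHom.mem_ker, powMonoidHom_apply] at hu
    rw [mem_rootsOfUnity, ← map_pow, hu, map_one]
  · rintro ⟨a, ha⟩ ⟨b, hb⟩ h
    simp only [Subtype.mk.injEq] at h
    exact Subtype.ext (hι_inj h)
  · rintro ⟨x, hx⟩
    rw [mem_rootsOfUnity] at hx
    have hval : Valued.v (x : v.adicCompletion K) = 1 := by
      refine valued_eq_one_of_pow_eq_one K v hn x.ne_zero ?_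
      rw [← map_pow, ← Units.val_pow_eq_pow_val, hx, Units.val_one, map_one]
    obtain ⟨u, hu⟩ := (Literature.NumberTheory.QuadraticForms.mem_range_unitsMap_integer_iff K v x).mpr hval
    have hu' : u ∈ (powMonoidHom n : (𝒪[v.adicCompletion K])ˣ →* _).ker := by
      rw [MonoidHom.mem_ker, powMonoidHom_apply]
      apply hι_inj
      rw [map_pow, map_one, hu, hx]
    exact ⟨⟨u, hu'⟩, Subtype.ext hu⟩

/-- **`(K_vˣ : K_vˣⁿ) = n · #𝒪_vˣ[n] · #(𝒪_v / n𝒪_v)`** (Neukirch II (5.8): the tree's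
`index_range_powMonoidHom_eq_mul_units` and `index_range_powMonoidHom_units` combined).
[cite: NeukirchANT1999, Ch. II §5 Prop. (5.8)] -/
theorem index_range_powMonoidHom_adicCompletion_eq {n : ℕ} (hn : n ≠ 0) :
    ((powMonoidHom n : (v.adicCompletion K)ˣ →* (v.adicCompletion K)ˣ).range).index =
      n * (Nat.card (powMonoidHom n : (𝒪[v.adicCompletion K])ˣ →* (𝒪[v.adicCompletion K])ˣ).ker *
        Nat.card (𝒪[v.adicCompletion K] ⧸ Ideal.span {(n : 𝒪[v.adicCompletion K])})) := by
  rw [index_range_powMonoidHom_eq_mul_units K v hn, index_range_powMonoidHom_units K v hn]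

/-- `K_v` has characteristic `0`, so `n ≠ 0` in `K_v`. [folklore] -/
private theorem neZero_natCast_adicCompletion (n : ℕ) [NeZero n] :
    NeZero ((n : ℕ) : v.adicCompletion K) := by
  haveI : CharZero (v.adicCompletion K) :=
    charZero_of_injective_algebraMap (algebraMap K _).injective
  exact NeZero.charZero

/-- **`#H¹(K_v, μ_n) = n · #𝒪_vˣ[n] · #(𝒪_v/n𝒪_v)`**: Kummer theory `H¹(K_v, μ_n) ≃ K_vˣ/K_vˣⁿ`
(`kummerEquiv`) and the index `(K_vˣ : K_vˣⁿ)`. [cite: SerreGaloisCohomology1997, II §5.7 (proof of Lemme 5)]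
[cite: NeukirchANT1999, Ch. II §5 Prop. (5.8)] -/
theorem natCard_continuousCohomology_one_mu_adicCompletion (n : ℕ) [NeZero n] :
    Nat.card (continuousCohomology 1 (mu (v.adicCompletion K) n).toTopRep) =
      n * (Nat.card (powMonoidHom n : (𝒪[v.adicCompletion K])ˣ →* (𝒪[v.adicCompletion K])ˣ).ker *
        Nat.card (𝒪[v.adicCompletion K] ⧸ Ideal.span {(n : 𝒪[v.adicCompletion K])})) := by
  haveI := neZero_natCast_adicCompletion K v n
  rw [← index_range_powMonoidHom_adicCompletion_eq K v (NeZero.ne n), Subgroup.index]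
  exact (Nat.card_congr (kummerEquiv (v.adicCompletion K) n).toEquiv).trans
    (Nat.card_congr Additive.toMul)

end AdicCompletion

/-! ### The Euler–Poincaré characteristic of `μ_n` over `K_v` -/

section EulerChar

open ValuativeRel

variable (K : Type u) [Field K] [NumberField K] (v : HeightOneSpectrum (𝓞 K))

/-- `𝒪[K_v]` (valuation ring of the `ValuativeRel` structure) has the same elements as the ring of
`v`-adic integers (tree `adicCompletion_valuation_le_one_iff`). [folklore] -/
private theorem valuativeRel_integer_eq_valued_integer :
    (valuation (v.adicCompletion K)).integer = Valued.integer (v.adicCompletion K) := by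
  ext x
  rw [Valuation.mem_integer_iff, adicCompletion_valuation_le_one_iff K v x,
    Valuation.mem_integer_iff, Valued.toNormedField.norm_le_one_iff]

/-- `#(𝒪[K_v] ⧸ m) = #(𝒪_v ⧸ m)` for `m : ℕ`, the two valuation rings having the same elements.
[folklore] -/
private theorem natCard_integer_quotient_natCast_eq (m : ℕ) :
    Nat.card ((valuation (v.adicCompletion K)).integer ⧸
        Ideal.span {((m : ℕ) : (valuation (v.adicCompletion K)).integer)}) =
      Nat.card (Valued.integer (v.adicCompletion K) ⧸
        Ideal.span {((m : ℕ) : Valued.integer (v.adicCompletion K))}) := by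
  have hO := valuativeRel_integer_eq_valued_integer K v
  let e : (valuation (v.adicCompletion K)).integer ≃+* Valued.integer (v.adicCompletion K) :=
    RingEquiv.subringCongr hO
  have hIJ : Ideal.span {((m : ℕ) : Valued.integer (v.adicCompletion K))} =
      (Ideal.span {((m : ℕ) : (valuation (v.adicCompletion K)).integer)}).map
        (e : (valuation (v.adicCompletion K)).integer →+* _) := by
    rw [Ideal.map_span, Set.image_singleton, map_natCast]
  exact Nat.card_congr (Ideal.quotientEquiv _ _ e hIJ).toEquiv

/-- **Tate's local Euler–Poincaré characteristic formula for `μ_n` over `K_v`** (Milne, *ADT*, I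
Thm. 2.8, for the module `M = μ_n(K̄_v)` of order `n`): `H¹(K_v, μ_n)` and `H²(K_v, μ_n)` are finite and
`#μ_n(K̄_v)^{Γ_{K_v}} · #H²(K_v, μ_n) · #(𝒪[K_v] ⧸ n) = #H¹(K_v, μ_n)` — i.e. the conclusion of the
tree's named fact `localEulerPoincareCharacteristic (v.adicCompletion K)` holds for `ρ = mu K_v n`.
Assembled from `#H⁰ = #μ_n(K_v) = #𝒪_vˣ[n]` (`natCard_invariants_mu`,
`natCard_rootsOfUnity_adicCompletion_eq`), `#H² = n` (the tree's `natCard_two_mu_eq` at `E = K_v`, cf.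
`natCard_two_mu_absoluteGaloisGroup_eq`) and
`#H¹ = (K_vˣ : K_vˣⁿ) = n · #𝒪_vˣ[n] · #(𝒪_v/n)` (`natCard_continuousCohomology_one_mu_adicCompletion`).
[cite: MilneADT2006, Ch. I §2, Thm. 2.8 (p. 31)] [cite: SerreGaloisCohomology1997, II §5.7 Thm. 5] -/
theorem localEulerPoincareCharacteristic_mu_adicCompletion (n : ℕ) [NeZero n] :
    Finite (continuousCohomology 1 (mu (v.adicCompletion K) n).toTopRep) ∧
      Finite (continuousCohomology 2 (mu (v.adicCompletion K) n).toTopRep) ∧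
      Nat.card (mu (v.adicCompletion K) n).toTopRep.ρ.invariants *
          Nat.card (continuousCohomology 2 (mu (v.adicCompletion K) n).toTopRep) *
          Nat.card (𝒪[v.adicCompletion K] ⧸
            Ideal.span {((Nat.card (MuCarrier (v.adicCompletion K) n) : ℕ) : 𝒪[v.adicCompletion K])}) =
        Nat.card (continuousCohomology 1 (mu (v.adicCompletion K) n).toTopRep) := by
  haveI : CharZero (v.adicCompletion K) :=
    charZero_of_injective_algebraMap (algebraMap K _).injective
  haveI := neZero_natCast_adicCompletion K v n
  haveI := absoluteGaloisGroup_compactSpace (v.adicCompletion K)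
  have hn : n ≠ 0 := NeZero.ne n
  -- `#H²(K_v, μ_n) = n`: the tree's `natCard_two_mu_eq` at `E = K_v`, transported along `Gal(K̄_v/K_v) = Γ`
  have h2 : Nat.card (continuousCohomology 2 (mu (v.adicCompletion K) n).toTopRep) = n := by
    have hbot : ∀ g : absoluteGaloisGroup (v.adicCompletion K),
        g ∈ galFixing (v.adicCompletion K)
          (⊥ : IntermediateField (v.adicCompletion K) (AlgebraicClosure (v.adicCompletion K))) :=
      fun g => by
        rw [galFixing_bot]
        trivial
    exact (Nat.card_congr (resHEquivOfTop (mu (v.adicCompletion K) n) _ hbot 2).toEquiv).trans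
      (natCard_two_mu_eq (v.adicCompletion K) ⊥ n)
  -- the counts
  have hμ : Nat.card (MuCarrier (v.adicCompletion K) n) = n := by
    change Nat.card (rootsOfUnity n (AlgebraicClosure (v.adicCompletion K))) = n
    exact HasEnoughRootsOfUnity.natCard_rootsOfUnity _ n
  have h0 := (natCard_invariants_mu (v.adicCompletion K) n).trans
    (natCard_rootsOfUnity_adicCompletion_eq K v hn)
  have h1 := natCard_continuousCohomology_one_mu_adicCompletion K v n
  -- finiteness
  have hpos1 : Nat.card (continuousCohomology 1 (mu (v.adicCompletion K) n).toTopRep) ≠ 0 := by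
    rw [h1, ← index_range_powMonoidHom_adicCompletion_eq K v hn]
    exact index_range_powMonoidHom_ne_zero K v hn
  have hfin1 : Finite (continuousCohomology 1 (mu (v.adicCompletion K) n).toTopRep) :=
    Nat.finite_of_card_ne_zero hpos1
  have hfin2 : Finite (continuousCohomology 2 (mu (v.adicCompletion K) n).toTopRep) :=
    Nat.finite_of_card_ne_zero (by rw [h2]; exact hn)
  refine ⟨hfin1, hfin2, ?_⟩
  rw [hμ, h0, h2, h1, natCard_integer_quotient_natCast_eq K v n]
  ring

end EulerChar

end Literature.NumberTheory.GaloisRepresentations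

end
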